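import Summits.ResolutionOfSingularities.ResolutionOfSingularities.Theorems.RestrictCutCells
import Literature.AlgebraicGeometry.Resolution.WeightedOrderChainLaw
import Literature.AlgebraicGeometry.Resolution.RegularSystemOfParameters
import HarnessLib

/-!
# CurveCutKernels — decomp-res node «CurveCut» (lens-4 g35, critic row 199 BOOKED 0), tree file 1/3 of the node

Content VERBATIM from the decomp-res lens-4 g35 node `HOME/decomp-res-lens-4/g35/CurveCut.lean` (pin bedce505, 513
l; HOME = run/shared/lean/pub/decomp-res): NO carry — the node imports the LANDED tree only (g34 «RestrictCut» =
`Theorems/RestrictCutKernels` · `RestrictCutKernels2` · `RestrictCutCells` · `MaxContactCutRestrictCut`, landed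
2026-08-31 by writer g12; Literature `WeightedOrderChainLaw` (Cossart–Piltant's weighted-order chain law
`le_pow_span_of_nearChain`) and `RegularSystemOfParameters`); every declaration is new, same namespace
`…Theorems.HugValuationCut` (no collision with the 90+ landed files of that namespace — checked by name).  Farm
(node; lens + critic runs): rc 0 · 0 err · 0 warn · 0 sorry; `--axioms` std on `noTower_threefold_followsLine`,
`noWildOccultDivisorialThreefoldLineMixedTowers_holds`, `noWildOccultDivisorialOrNonThreefoldMixedTowers_iff_g35`,
`mem_stalkIdeal_controlledTransform_of_mul_mem`, `CornerGame.no_cornerRun`; Probe rc 0 (26 must-fail sorries = the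
batteries M1–M14 / V1–V6 / P0–P7).  Critic: CRITIC-LEDGER row 199 «CurveCut» BOOKED 0 on lane (NP-C) of window row
194 (content lands at 0-weight: a GENUINE PORT-FREE KERNEL LAW + cells; MAP (M-CurveLaw) registered — the
regular-curve half of the port `CurveLaw` of the closed hug-dimension-1 column, rd 3): the LETTER `FollowsLineTower`
(«from some stage on the marked points run along the strict transforms of ONE regular curve germ, in compatible
regular parameters `(u; y₂, y₃)`») and the WHOLE-KIND KILL `noTower_threefold_followsLine` — every `p`, every field,
EVERY class `P`, every weight `n ≥ 1`: NO forced threefold tower follows a regular curve germ (chain law + the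
τ-chain dictionary of Law A + isolation of the marked point, tree `tower_not_map_le_pow_base`); the cut of CELL C
(occult divisorial) by ring dimension and by the letter: C = C₃ ∧ C₄, C₃ = C₃ˡ ∧ C₃♮, C₃ˡ EMPTY IN KERNEL, C₃♮
(follows NO line — the ruled / kangaroo core) and C₄ UNDECIDED (honest tags), with the EXACT HYPOTHESIS-FREE
re-locations down to THE LOCATED RESIDUAL after g35 `NoWildOccultNonLineMixedTowers` (= (C₃♮ ∧ C₄) ∧ D₄); and, as a
typed DESK LAW outside CELL C, the termination of the corner-pair exponent game (`CornerGame.no_cornerRun`).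
Landing orders = critic rider INBOX :1236 (2026-08-31T08:49:13Z) = the NODE landing form (the three `══ FILE`
markers): FILE 1 `CurveCutKernels` = §111–§112 (cone-free; the node's imports), FILE 2 `CurveCutCells` = §113
(cone-free; imports FILE 1; the cells BY NAME as in g33/g34, cn26), FILE 3 `CurveCutCornerGame` = §114 (pure
combinatorics; imports `Mathlib` + `HarnessLib` only; sub-namespace `CornerGame`); all VERBATIM, `--kind proof
--supports stmt-ResolutionOfSingularities-28338`; no Theses-cone file this generation.  ASIDE 28338 bookkeeping
(rider: «if the row-194 switch is already filed, NO further switch — docstring mention only»): the row-194 switch to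
the g34 located residual `NoWildOccultDivisorialOrNonThreefoldMixedTowers` (home `RestrictCutCells`) WAS filed by
writer g12 (route rev 59 → item 26902); the g35 located residual `NoWildOccultNonLineMixedTowers` (home
`CurveCutCells`, THIS node) refines it hypothesis-free (`noWildOccultDivisorialOrNonThreefoldMixedTowers_iff_g35`;
for the tree aside: `noWildOccultNonLineMixedTowers_of_aside`).  The `def … : Prop` declarations
(`FollowsLineTower`, `WildOccultDivisorialThreefoldMixedWallFreeFreshJumpShallowCompanionKangarooTowersTerminate`,
`WildOccultDivisorialNonThreefoldMixedWallFreeFreshJumpShallowCompanionKangarooTowersTerminate`,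
`WildOccultDivisorialThreefoldLineMixedWallFreeFreshJumpShallowCompanionKangarooTowersTerminate`,
`WildOccultDivisorialThreefoldNonLineMixedWallFreeFreshJumpShallowCompanionKangarooTowersTerminate`,
`NoWildOccultDivisorialThreefoldMixedTowers`, `NoWildOccultDivisorialNonThreefoldMixedTowers`,
`NoWildOccultDivisorialThreefoldLineMixedTowers`, `NoWildOccultDivisorialThreefoldNonLineMixedTowers`,
`NoWildOccultNonLineMixedTowers`, `CornerGame.CornerState.Valid`, `CornerGame.IsCornerRun`) are THIS node's letter /
cells (cn26) / game predicates — none is a vendored fact; `CornerGame.CornerState` is a plain `structure` of four naturals.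

The lens header, verbatim:

> # CurveCut — decomp-res-lens-4 g35 node «CurveCut» (lane (NP-C) of CRITIC row 194: the LINE-FOLLOWING KERNEL of forced
> towers — the letter `FollowsLineTower` «from some stage on the marked points run along the strict transforms of ONE regular
> curve germ, in compatible regular parameters `(u; y₂, y₃)`», and the WHOLE-KIND KILL `noTower_threefold_followsLine` — every
> `p`, every field, EVERY class `P`, every weight `n ≥ 1`: NO forced threefold tower follows a regular curve germ (port-free:
> Cossart–Piltant's weighted-order chain law `le_pow_span_of_nearChain` + the τ-chain dictionary of Law A + the isolation of the
> marked point, tree `tower_not_map_le_pow_base`); then the cut of CELL C (occult divisorial) by ring dimension and by the new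
> letter, with exact hypothesis-free re-locations; and, as a typed DESK LAW outside CELL C, the termination of the
corner-pair exponent game
> of a two-factor datum (the alignment mechanism in its monomial regime); see the module docstrings of §111–§114 and
> HOME/decomp-res-lens-4/g35/NODE-g35.md).
>
> NO CARRY: g34 «RestrictCut» is in the tree (`Theorems/RestrictCutKernels.lean`, `RestrictCutKernels2.lean`,
> `RestrictCutCells.lean`, `MaxContactCutRestrictCut.lean`, landed 2026-08-31) and is IMPORTED; this file imports
the landed tree
> only.  Landing form (three tree files, in this order, cut at the `══ FILE` markers): FILE 1 `Theorems/CurveCutKernels.lean` =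
> §111–§112 (cone-free: imports `RestrictCutCells` + two Literature files), FILE 2 `Theorems/CurveCutCells.lean` = §113
> (cone-free: imports FILE 1), FILE 3 `Theorems/CurveCutCornerGame.lean` = §114 (pure combinatorics: imports `Mathlib` /
> `HarnessLib` only; sub-namespace `CornerGame`).  No Theses-cone file this generation (the g34 re-locations modulo 31571 / the
> surface port compose with `noWildOccultDivisorialOrNonThreefoldMixedTowers_iff_g35` by `Iff.trans`; see bc/Probe P5).

## This file

§111 (g35 · NEW · LETTER) THE LINE-FOLLOWING LETTER of a forced tower (`section LineLetter`: `lineRing` / `lineMap`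
/ `lineIdeal` = the chain rings, stalk maps and marked stalk ideals of the tower shifted to stage `m`, typed as in
Law A via `chainRing`; **`FollowsLineTower T`** = ∃ stage `m` and COMPATIBLE regular systems of parameters `(u_j;
y₂⁽ʲ⁾, y₃⁽ʲ⁾)`, `φ_j(u_j) = u_{j+1}`, `φ_j(y_i⁽ʲ⁾) = u_{j+1}·y_i⁽ʲ⁺¹⁾` — the tower runs along ONE regular curve germ
for ever); §112 (NEW · KERNEL) THE LINE-FOLLOWING LAW (`section LineLaw`): the ring lemmas
`span_triple_mul_eq_span_singleton`, `mem_stalkIdeal_controlledTransform_of_mul_mem` (weak-transform divisibility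
through `IsBlowup.stalkIdeal_controlledTransform`), `isPrime_span_pair_and_ne_of_rsop`,
`map_le_pow_maximalIdeal_localization_of_le_pow`, and the WHOLE-KIND KILL **`noTower_threefold_followsLine`** (every
`p`, field, class `P`, weight `n ≥ 1`; port-free: Literature chain law `le_pow_span_of_nearChain` + isolation
`tower_not_map_le_pow_base`) with its priced name `noTowerWild_threefold_followsLine`.

[WRITER NOTE (decomp-res writer g13): file split only, at the node's own `══ FILE` markers (tree files ≤ 400 lines);
namespace, sections, section variables, the sub-namespaces `CornerGame` / `CornerGame.CornerState` and every
declaration exactly as in the lens (the node's HOME-only dupNamespace-linter line is dropped — the library sets it;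
`noncomputable section` and the namespace-level `open` lines of the node are replayed in `CurveCutKernels` /
`CurveCutCells`; `CurveCutCornerGame` imports `Mathlib` + `HarnessLib` only, as the marker says, so it carries
neither — §114 names no tree declaration).]

(Sources: CossartPiltant2008 Prop. 4.4 (weighted-order chain law); Matsumura1987 Thms. 14.3, 17.8 (regular systems
of parameters); Hironaka1964 Ch. III; Giraud1975; CossartJannsenSaito2020 Thm. 6.40, Ch. 8; Hauser2010Kangaroo;
HauserPerlega2019 §2; Kollar2007 3.58–3.60; StacksProject 00NQ / 0AFT.)
-/

noncomputable section

open CategoryTheory AlgebraicGeometry IsLocalRing TopologicalSpace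
open Literature.AlgebraicGeometry.Resolution
open Summit.ResolutionOfSingularities.ResolutionOfSingularities.Theorems
open WeakOrderReduction ForcedTowerClasses DivergentTowerClasses MonomialTowerClasses
open HugDimensionClasses HugDimensionKernels SurfaceShadowClasses SurfaceShadowKernels
open NearPointCut (SingularClass)
open Scheme.IdealSheafData (vanishingIdeal)
open scoped BigOperators

namespace Summit.ResolutionOfSingularities.ResolutionOfSingularities.Theorems.HugValuationCut

section LineLetter

/-! ## ══ FILE 1/3 `Theorems/CurveCutKernels.lean` (§111–§112; cone-free) ══ -/

/-! ## §111 (g35 · NEW · LETTER) THE LINE-FOLLOWING LETTER OF A FORCED TOWER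

The structural letter of this generation, stated BY MECHANISM and IN THE RING (no port, no ideal-sheaf spreading): a forced
tower `T` FOLLOWS A LINE from stage `m` if the local rings `R_j := 𝒪_{X_{m+j}, x_{m+j}}` (typed, as in Law A, as the chain rings
`chainRing` of the shifted tower at the base points `π_{m+j}(x_{m+j+1}) = x_{m+j}`) carry regular systems of parameters
`(u_j; y₂⁽ʲ⁾, y₃⁽ʲ⁾)` COMPATIBLE WITH THE BLOW-UPS IN THE `u`-CHART:
`φ_j(u_j) = u_{j+1}`, `φ_j(y_i⁽ʲ⁾) = u_{j+1}·y_i⁽ʲ⁺¹⁾` (`φ_j` = the stalk map `chainMap`).  Geometrically: `x_{m+j+1}` is the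
point of the strict transform of the regular curve germ `Γ_j = V(y₂⁽ʲ⁾, y₃⁽ʲ⁾) ∋ x_{m+j}`, and `Γ_{j+1} = V(y₂⁽ʲ⁺¹⁾, y₃⁽ʲ⁺¹⁾)`
is that strict transform — THE TOWER RUNS ALONG ONE REGULAR CURVE GERM FOR EVER.  This is the «curve case» of the
`H`-non-isolated mechanism of CELL C (NEXT-g35 §1(c): the companion surface `Top(H)` contains an equimultiple regular curve and
the marked points follow it) isolated as a tower letter of its own; it is the REGULAR-CURVE HALF of the old hug-dimension-1
letter `CurveHugging` (g≤20, decided modulo the port `CurveLaw`), now typed so that the kernel can kill it. -/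

/-- the chain rings of the tower shifted to stage `m`: `lineRing T m j = 𝒪_{X_{m+j}, π_{m+j}(x_{m+j+1})}` (`= 𝒪_{x_{m+j}}`
by `pt_map`). -/
abbrev lineRing (T : ForcedTower) (m j : ℕ) : Type :=
  chainRing (fun j => T.St (m + j)) (fun j => T.π (m + j)) (fun j => T.pt (m + j + 1)) j

/-- the chain maps of the shifted tower: `lineMap T m j : 𝒪_{x_{m+j}} → 𝒪_{x_{m+j+1}}` (stalk map at `x_{m+j+1}`, then the
bookkeeping identification `x_{m+j+1} = π_{m+j+1}(x_{m+j+2})`). -/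
def lineMap (T : ForcedTower) (m j : ℕ) : lineRing T m j →+* lineRing T m (j + 1) :=
  chainMap (fun j => T.St (m + j)) (fun j => T.π (m + j)) (fun j => T.pt (m + j + 1)) (fun j => T.pt_map (m + j + 1)) j

/-- the marked stalk ideals along the shifted tower: `lineIdeal T m j = 𝓘_{m+j, x_{m+j}}`. -/
def lineIdeal (T : ForcedTower) (m j : ℕ) : Ideal (lineRing T m j) :=
  chainIdeal (fun j => T.St (m + j)) (fun j => T.π (m + j)) (fun j => T.pt (m + j + 1)) (fun j => (T.D (m + j)).ideal) j

/-- **LETTER (g35 · structural, by mechanism): THE TOWER FOLLOWS A LINE** — from some stage `m` on there are regular systems of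
parameters `(u_j; y₂⁽ʲ⁾, y₃⁽ʲ⁾)` of the local rings at the marked points, compatible with the blow-ups in the `u`-chart:
`φ_j u_j = u_{j+1}`, `φ_j y_i⁽ʲ⁾ = u_{j+1} y_i⁽ʲ⁺¹⁾`; i.e. the marked points run along the strict transforms of the
regular curve
germ `V(y₂, y₃)`. -/
def FollowsLineTower (T : ForcedTower) : Prop :=
  ∃ m : ℕ, ∃ u y₂ y₃ : (j : ℕ) → lineRing T m j,
    (∀ j, Ideal.span {u j, y₂ j, y₃ j} = maximalIdeal (lineRing T m j)) ∧
    (∀ j, lineMap T m j (u j) = u (j + 1)) ∧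
    (∀ j, lineMap T m j (y₂ j) = u (j + 1) * y₂ (j + 1)) ∧
    (∀ j, lineMap T m j (y₃ j) = u (j + 1) * y₃ (j + 1))

end LineLetter

section LineLaw

variable {k : Type} [Field k]

/-! ## §112 (g35 · NEW · KERNEL) THE LINE-FOLLOWING LAW: NO FORCED THREEFOLD TOWER FOLLOWS A LINE

PROOF (Cossart–Piltant 2008, proof of Prop. 4.4 p. 11 «standard arguments», typed in the tree as the weighted-order chain law
`le_pow_span_of_nearChain`; every `p`, every field, every class, every weight `n ≥ 1`).  Along the chain the WEAK-TRANSFORM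
DIVISIBILITY `u_{j+1}^n · g ∈ 𝓘_j 𝒪_{j+1} ⇒ g ∈ 𝓘_{j+1}` holds (the marked ideal of the next stage is the weight-`n` controlled
transform, whose stalk is the colon `(𝓘_j 𝒪 : (u_{j+1})^n)` — `IsBlowup.stalkIdeal_controlledTransform`, the exceptional ideal
at `x_{j+1}` being `𝔪_j 𝒪_{j+1} = (u_{j+1})` by the letter), and `𝓘_j ⊆ 𝔪_j^n` at every stage; the chain law then gives
`𝓘_m ⊆ (y₂, y₃)^n` IN THE RING `𝒪_{x_m}`: the marked ideal has order `n` along the regular curve germ `𝔮 = (y₂, y₃)` (a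
NON-MAXIMAL PRIME: part of a regular system of parameters, Matsumura 17.8 / 14.3), i.e. `𝓘_m 𝒪_𝔮 ⊆ 𝔮^n 𝒪_𝔮` — contradicting
the ISOLATION of the marked point in the weight-`n` locus (tree `tower_not_map_le_pow_base`: no non-maximal prime carries
order `≥ n`).  No G-ring / completion input is needed (the curve is algebraic by the letter).  TWIN IN THE TREE (named, not
used, not restated): lens-6 g17's BRANCH-frame regular-curve law at every marking
(`AbsoluteContactClasses.curveFrame_strictIterN`,
`hugsTop_of_hugsRegCurve`, `curveLaw3`; CRITIC row 128; depth-ideal descent on `SatelliteExitClasses.Branch`) proves «a hugged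
regular curve germ is a top curve» for branches with point and foreign rounds; §112 is the `ForcedTower`-frame statement over
compatible parameters, proved from the Literature chain law instead — the two tower structures are not related by any tree
theorem, so neither law yields the other by name. -/

/-- in a local ring, `(u, u y₂, u y₃) = (u)`. [folklore] -/
theorem span_triple_mul_eq_span_singleton {R : Type*} [CommRing R] (u y₂ y₃ : R) :
    Ideal.span ({u, u * y₂, u * y₃} : Set R) = Ideal.span {u} := by
  apply le_antisymm
  · rw [Ideal.span_le]
    rintro z hz
    simp only [Set.mem_insert_iff, Set.mem_singleton_iff] at hz
    rcases hz with rfl | rfl | rfl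
    · exact Ideal.subset_span rfl
    · exact Ideal.mul_mem_right _ _ (Ideal.subset_span rfl)
    · exact Ideal.mul_mem_right _ _ (Ideal.subset_span rfl)
  · exact Ideal.span_mono (Set.singleton_subset_iff.mpr (Set.mem_insert u _))

/-- **THE WEAK-TRANSFORM DIVISIBILITY at a point blow-up step** (ring form): if `σ : X' → X` is the blow-up of the reduced
closed point `x = σ x'`, `𝓘' = ` the weight-`μ` controlled transform of `𝓘`, and `(u; y₂, y₃)` generate `𝔪_x` with
`σ^#(u) = u'`, `σ^#(y_i) = u' y_i'`, then `u'^μ g ∈ 𝓘_x 𝒪_{x'} ⇒ g ∈ 𝓘'_{x'}` — transported to a point `q = x'`.  [folklore] -/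
theorem mem_stalkIdeal_controlledTransform_of_mul_mem {X X' : Scheme.{0}} (σ : X' ⟶ X) (x' q : X') (h : q = x')
    (hcl : IsClosed ({σ x'} : Set X)) (hσ : IsBlowup σ (vanishingIdeal ⟨{σ x'}, hcl⟩)) (I : X.IdealSheafData) (μ : ℕ)
    {u y₂ y₃ : X.presheaf.stalk (σ x')} (hgen : Ideal.span {u, y₂, y₃} = maximalIdeal _)
    {u' y₂' y₃' : X'.presheaf.stalk q} (hu : stalkMapCongr σ x' q h u = u') (hy₂ : stalkMapCongr σ x' q h y₂ = u' * y₂')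
    (hy₃ : stalkMapCongr σ x' q h y₃ = u' * y₃') (g : X'.presheaf.stalk q)
    (hg : u' ^ μ * g ∈ (stalkIdeal I (σ x')).map (stalkMapCongr σ x' q h)) :
    g ∈ stalkIdeal (controlledTransform σ (vanishingIdeal ⟨{σ x'}, hcl⟩) I μ) q := by
  subst h
  rw [stalkMapCongr_self] at hu hy₂ hy₃ hg
  rw [hσ.stalkIdeal_controlledTransform I μ q, stalkIdeal_comap_eq_map_stalkMap, stalkIdeal_comap_eq_map_stalkMap,
    stalkIdeal_vanishingIdeal_singleton hcl, ← hgen, Ideal.map_span, Set.image_insert_eq, Set.image_insert_eq,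
    Set.image_singleton, hu, hy₂, hy₃, span_triple_mul_eq_span_singleton, Ideal.span_singleton_pow]
  refine Submodule.mem_colon.mpr ?_
  intro p hp
  obtain ⟨a, rfl⟩ := Ideal.mem_span_singleton'.mp hp
  rw [smul_eq_mul, show g * (a * u' ^ μ) = a * (u' ^ μ * g) by ring]
  exact Ideal.mul_mem_left _ _ hg

/-- in a regular local ring of dimension 3 with regular parameters `(u; y₂, y₃)`, the ideal `(y₂, y₃)` is a prime different
from the maximal ideal (Matsumura 17.8 / 14.3: part of a regular system of parameters). [folklore] -/
theorem isPrime_span_pair_and_ne_of_rsop {R : Type*} [CommRing R] [IsRegularLocalRing R]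
    (hd : (maximalIdeal R).spanFinrank = 3) {u y₂ y₃ : R} (hgen : Ideal.span {u, y₂, y₃} = maximalIdeal R) :
    (Ideal.span ({y₂, y₃} : Set R)).IsPrime ∧ Ideal.span ({y₂, y₃} : Set R) ≠ maximalIdeal R := by
  classical
  set x : Fin 3 → R := ![u, y₂, y₃] with hx
  have hrange : Set.range x = {u, y₂, y₃} := by
    ext z
    simp only [Set.mem_range, Set.mem_insert_iff, Set.mem_singleton_iff, hx]
    constructor
    · rintro ⟨i, rfl⟩
      fin_cases i <;> simp
    · rintro (rfl | rfl | rfl)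
      exacts [⟨0, rfl⟩, ⟨1, rfl⟩, ⟨2, rfl⟩]
  have hxspan : Ideal.span (Set.range x) = maximalIdeal R := by rw [hrange, hgen]
  have himg : x '' (({1, 2} : Finset (Fin 3)) : Set (Fin 3)) = {y₂, y₃} := by
    rw [Finset.coe_insert, Finset.coe_singleton, Set.image_insert_eq, Set.image_singleton]
    simp [hx]
  refine ⟨?_, ?_⟩
  · have h := isPrime_span_image hd x hxspan {1, 2}
    rwa [himg] at h
  · intro heq
    have hfin : ({y₂, y₃} : Set R).Finite := Set.toFinite _
    have h1 : (maximalIdeal R).spanFinrank ≤ ({y₂, y₃} : Set R).ncard := by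
      rw [← heq]; exact Submodule.spanFinrank_span_le_ncard_of_finite hfin
    have h2 : ({y₂, y₃} : Set R).ncard ≤ 2 := by
      refine (Set.ncard_insert_le y₂ {y₃}).trans ?_
      rw [Set.ncard_singleton]
    omega

/-- `J ⊆ 𝔮^μ` gives `J 𝒪_𝔮 ⊆ (𝔮 𝒪_𝔮)^μ` in the localisation at the prime `𝔮`. [folklore] -/
theorem map_le_pow_maximalIdeal_localization_of_le_pow {R : Type*} [CommRing R] (𝔮 : Ideal R) [𝔮.IsPrime] {J : Ideal R}
    {μ : ℕ} (hJ : J ≤ 𝔮 ^ μ) :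
    J.map (algebraMap R (Localization.AtPrime 𝔮)) ≤ maximalIdeal (Localization.AtPrime 𝔮) ^ μ := by
  rw [← Localization.AtPrime.map_eq_maximalIdeal, ← Ideal.map_pow]
  exact Ideal.map_mono hJ

/-- **THE LINE-FOLLOWING LAW (KERNEL, PROVED; every `p`, every field, every class `P`, every weight `n ≥ 1`): NO forced tower
of ring dimension 3 follows a line.**  (Sources: CossartPiltant2008, proof of Prop. 4.4 p. 11; Matsumura1987, Thm. 14.3, 17.8;
tree `le_pow_span_of_nearChain`, `tower_not_map_le_pow_base`.)  Stated for EVERY weight `n` (for `n = 0` the isolation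
letter is already absurd). -/
theorem noTower_threefold_followsLine (n : ℕ) (P : ForcedTower → Prop) :
    NoTower n fun T => P T ∧ ThreefoldTower T ∧ FollowsLineTower T := by
  intro p hp K _ _ T g hB hD hE hT
  obtain ⟨-, h3, m, u, y₂, y₃, hgen, hu, hy₂, hy₃⟩ := hT
  have hNR := tower_isLocallyNoetherian_isRegular T g hB
  haveI : ∀ i, IsLocallyNoetherian (T.St i) := fun i => (hNR i).1
  haveI hreg : ∀ j, IsRegularLocalRing (lineRing T m j) := fun j => tower_isRegular T g hB (m + j) _
  -- embedding dimension and ring dimension 3 along the chain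
  have hsf : ∀ j, (maximalIdeal (lineRing T m j)).spanFinrank = 3 := fun j =>
    tower_spanFinrank_eq_three_base T g hB h3 (m + j)
  have hdim : ∀ j, ringKrullDim (lineRing T m j) = 3 := fun j => by
    change ringKrullDim ((T.St (m + j)).presheaf.stalk ((T.π (m + j)).base (T.pt (m + j + 1)))) = 3
    rw [T.pt_map]; exact ringKrullDim_eq_three_of_threefoldTower h3 (m + j)
  -- `𝓘_j ⊆ 𝔪_j^n` along the chain
  have hJμ : ∀ j, lineIdeal T m j ≤ maximalIdeal (lineRing T m j) ^ n := fun j =>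
    stalkIdeal_le_pow_of_eq _ (T.pt_map (m + j)) (tower_stalkIdeal_le_pow T hD (m + j))
  -- the weak-transform divisibility along the chain
  have hJ : ∀ j (g' : lineRing T m (j + 1)), u (j + 1) ^ n * g' ∈ (lineIdeal T m j).map (lineMap T m j) →
      g' ∈ lineIdeal T m (j + 1) := fun j g' hg' => by
    have h := mem_stalkIdeal_controlledTransform_of_mul_mem (T.π (m + j)) (T.pt (m + j + 1))
      ((T.π (m + j + 1)).base (T.pt (m + j + 1 + 1))) (T.pt_map (m + j + 1)) (tower_isClosed_base T (m + j))
      (tower_isBlowup_base T (m + j)) (T.D (m + j)).ideal n (hgen j) (hu j) (hy₂ j) (hy₃ j) g' hg'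
    change g' ∈ stalkIdeal (T.D (m + j + 1)).ideal ((T.π (m + j + 1)).base (T.pt (m + j + 1 + 1)))
    rwa [tower_ideal_succ_eq_controlledTransform_base T hD (m + j)]
  -- Cossart–Piltant: `𝓘_m ⊆ (y₂, y₃)^n` in `𝒪_{x_m}`
  have hle : lineIdeal T m 0 ≤ Ideal.span {y₂ 0, y₃ 0} ^ n :=
    le_pow_span_of_nearChain (lineMap T m) u y₂ y₃ hgen hdim hu hy₂ hy₃ (lineIdeal T m) hJμ hJ
  -- the regular curve germ `𝔮 = (y₂, y₃)` is a non-maximal prime carrying order `≥ n`: contradiction with isolation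
  obtain ⟨h𝔮, h𝔮ne⟩ := isPrime_span_pair_and_ne_of_rsop (hsf 0) (hgen 0)
  haveI := h𝔮
  exact tower_not_map_le_pow_base T hD m (Ideal.span {y₂ 0, y₃ 0}) h𝔮ne
    (map_le_pow_maximalIdeal_localization_of_le_pow _ hle)

/-- **THE LINE-FOLLOWING LAW on the wild column** (`p ∣ n`, `n ≥ 1`). [folklore] -/
theorem noTowerWild_threefold_followsLine (n : ℕ) (P : ForcedTower → Prop) :
    NoTowerWild n fun T => P T ∧ ThreefoldTower T ∧ FollowsLineTower T := by
  intro p hp hpn K _ _ T g hB hD hE hT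
  exact noTower_threefold_followsLine n P p hp K T g hB hD hE hT

end LineLaw

end Summit.ResolutionOfSingularities.ResolutionOfSingularities.Theorems.HugValuationCut
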